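import Mathlib
import Summits.MatrixMultiplication.MatrixMultiplication.Theorems.SnSubsetDichotomyPolynomialSlackPinningNormalized
import Summits.MatrixMultiplication.MatrixMultiplication.Theorems.SnSubsetDichotomyPolynomialSlackKeptTerm
import Summits.MatrixMultiplication.MatrixMultiplication.Theorems.SnSubsetDichotomyPolynomialSlackPairParseval
import Summits.MatrixMultiplication.MatrixMultiplication.Theorems.SnSubsetDichotomyPolynomialSlackPairLightEnergy
import Summits.MatrixMultiplication.MatrixMultiplication.Theorems.SnSubsetDichotomyPolynomialSlackStubSplit
import Summits.MatrixMultiplication.MatrixMultiplication.Theorems.SnSubsetDichotomyPolynomialSlackMarginals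

/-!
# The kept term when only the quotient `C = U⁻¹S` is split

Crux `Summit.MatrixMultiplication.MatrixMultiplication.Theses.SnSubsetDichotomy.PolynomialSlack`
(item `stmt-MatrixMultiplication-8306`), level-one programme, line transport-split-hull (lead c6,
"beyond one half"): REDUCTION TO THE KEPT TERM in the case of two dense quotients. For a parity-pure
TPP triple `S, T, U ⊆ S_n` (`n ≥ 40`) write `N = |S||T||U|`, `α = |S||T|`, `β = |T||U|`,
`γ = |U||S|` (`αβγ = N²`), `K_A = n!/α`, `K_B = n!/β`, `K_C = n!/γ`, `F = n!√(n!)/N`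
(`K_A K_B K_C = F²`), and let `a = d_A - 1/n`, `b = d_B - 1/n`, `c = d_C - 1/n` be the centred
profiles of the three quotients. Only `C` is split: with the heavy threshold `θ_C = n!/(γ n M)`
(`≥ 16/n` as `K_C ≥ 16M`) the heavy part is `p_C = c·[θ_C ≤ d_C]` and the light part
`l_C = c - p_C`. The tree lemma `kept_ge_of_split` (with `a = a + 0`, `b = b + 0`, `c = p_C + l_C`)
is fed with

* the normalised pinning `pinning_normalized` (`1 - δ₀ ≤ -(n-1)·Σ abc`,
  `δ₀ = n!/(2N) + n!√(n!)/(2N√(n(n-1)/6))`);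
* the Parseval bounds `pair_parseval` (`Σ a² ≤ K_A/(n-1)` etc., the three quotient maps being
  injective by `injOn_quot_first/second` and `TripleProductProperty.rotate`);
* the light-cell energy bound `pair_light_energy` (`Σ l_C² ≤ 100(1+log n)(K_C/M)·L_C/n` with
  `L_C = log(4n·n!/γ) ≤ L`, whence `Σ l_C² ≤ γ'·K_C/(n-1)` for `γ' = 100(1+log n)L/M`);

and its loss `3(n-1)√γ'·√(K_A K_B K_C/(n-1)³) = 3√γ'·F/√(n-1)` is the one of the statement:

* `kept_split_C` — `1 - δ₀ - 3√γ'·F/√(n-1) ≤ -(n-1)·Σ_{ijk} a_{ij} b_{jk} (p_C)_{ki}`.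
-/

namespace Summit.MatrixMultiplication.MatrixMultiplication.Theorems.PolynomialSlack

set_option linter.dupNamespace false

open scoped BigOperators
open Literature.Combinatorics.Additive (TripleProductProperty)

set_option maxHeartbeats 1600000 in
/-- **Kept term, only `C = U⁻¹S` split.** For `n ≥ 40`, a parity-pure TPP triple `S, T, U ⊆ S_n` of
non-empty sets with profiles `d_A, d_B, d_C` of `S⁻¹T`, `T⁻¹U`, `U⁻¹S`, parameters `M, L ≥ 1` with
`K_C = n!/(|U||S|) ≥ 16M` and `log(4n·n!/(|U||S|)) ≤ L`, and the heavy part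
`p_C = (d_C - 1/n)·[n!/(|U||S|·n·M) ≤ d_C]` of the centred profile of `C`:
`1 - (n!/(2N) + n!√(n!)/(2N√(n(n-1)/6)) + 3√(100(1+log n)L/M)·(n!√(n!)/N)/√(n-1))
   ≤ -(n-1)·Σ_{ijk} (d_A(i,j) - 1/n)(d_B(j,k) - 1/n)·p_C(k,i)` (`N = |S||T||U|`).
Proof: `kept_ge_of_split` with `pinning_normalized`, `pair_parseval` (three times) and
`pair_light_energy` (for `C`), and the identity `K_A K_B K_C = (n!√(n!)/N)²`. [folklore] -/
theorem kept_split_C {n : ℕ} (hn : 40 ≤ n) {S T U : Finset (Equiv.Perm (Fin n))}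
    (hTPP : TripleProductProperty S T U) (hS0 : S.Nonempty) (hT0 : T.Nonempty) (hU0 : U.Nonempty)
    (hS : ∀ s ∈ S, ∀ s' ∈ S, Equiv.Perm.sign s = Equiv.Perm.sign s')
    (hT : ∀ t ∈ T, ∀ t' ∈ T, Equiv.Perm.sign t = Equiv.Perm.sign t')
    (hU : ∀ u ∈ U, ∀ u' ∈ U, Equiv.Perm.sign u = Equiv.Perm.sign u')
    (dA dB dC pC : Fin n → Fin n → ℝ)
    (hdA : ∀ i j, dA i j = (((S ×ˢ T).filter fun st => st.2 j = st.1 i).card : ℝ) / (S.card * T.card : ℕ))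
    (hdB : ∀ j k, dB j k = (((T ×ˢ U).filter fun tu => tu.2 k = tu.1 j).card : ℝ) / (T.card * U.card : ℕ))
    (hdC : ∀ k i, dC k i = (((U ×ˢ S).filter fun us => us.2 i = us.1 k).card : ℝ) / (U.card * S.card : ℕ))
    (M L : ℝ) (hM : 1 ≤ M) (hL : 1 ≤ L)
    (hKC : 16 * M ≤ (n.factorial : ℝ) / (U.card * S.card : ℕ))
    (hLC : Real.log (4 * n * n.factorial / (U.card * S.card : ℕ)) ≤ L)
    (hpC : ∀ k i, pC k i =
      if (n.factorial : ℝ) / ((U.card * S.card : ℕ) * n * M) ≤ dC k i then dC k i - 1 / n else 0) :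
    1 - ((n.factorial : ℝ) / (2 * (S.card * T.card * U.card : ℕ)) +
          (n.factorial : ℝ) * Real.sqrt (n.factorial : ℝ) /
            (2 * (S.card * T.card * U.card : ℕ) * Real.sqrt (((n * (n - 1) : ℕ) : ℝ) / 6)) +
          3 * Real.sqrt (100 * (1 + Real.log n) * L / M) *
            ((n.factorial : ℝ) * Real.sqrt (n.factorial : ℝ) / (S.card * T.card * U.card : ℕ)) /
              Real.sqrt ((n : ℝ) - 1)) ≤
      -((n : ℝ) - 1) * ∑ i : Fin n, ∑ j : Fin n, ∑ k : Fin n,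
        (dA i j - 1 / n) * (dB j k - 1 / n) * pC k i := by
  -- scalars
  have hn1 : (1 : ℝ) ≤ n := by exact_mod_cast (show 1 ≤ n by omega)
  have hn40 : (40 : ℝ) ≤ n := by exact_mod_cast hn
  have hn0 : (0 : ℝ) < n := by linarith
  have hm0 : (0 : ℝ) < (n : ℝ) - 1 := by linarith
  have hM0 : 0 < M := by linarith
  have hL0 : 0 ≤ L := by linarith
  have hlog : 0 ≤ Real.log n := Real.log_nonneg hn1
  -- injectivity of the three quotient maps
  have hinjA := injOn_quot_first hTPP hU0
  have hinjB := injOn_quot_second hTPP hS0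
  have hinjC := injOn_quot_first hTPP.rotate.rotate hT0
  -- (1) the normalised pinning, in terms of the profiles
  have hpin : 1 - ((n.factorial : ℝ) / (2 * (S.card * T.card * U.card : ℕ)) +
      (n.factorial : ℝ) * Real.sqrt (n.factorial : ℝ) /
        (2 * (S.card * T.card * U.card : ℕ) * Real.sqrt (((n * (n - 1) : ℕ) : ℝ) / 6))) ≤
      -((n : ℝ) - 1) * ∑ i : Fin n, ∑ j : Fin n, ∑ k : Fin n,
        (dA i j - 1 / n) * (dB j k - 1 / n) * (dC k i - 1 / n) := by
    have h := pinning_normalized n hn S T U hTPP hS0 hT0 hU0 hS hT hU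
    simp only [← hdA, ← hdB, ← hdC] at h
    linarith [h]
  -- (2) the three Parseval bounds `(n-1)·Σ (d - 1/n)² ≤ K`
  have hpA := pair_parseval hn S T hS0 hT0 hinjA dA hdA
  have hpB := pair_parseval hn T U hT0 hU0 hinjB dB hdB
  have hpC2 := pair_parseval hn U S hU0 hS0 hinjC dC hdC
  -- (3) the light-cell energy of `C`
  have hθ : 1 / (n : ℝ) ≤ (n.factorial : ℝ) / ((U.card * S.card : ℕ) * n * M) := by
    have hγ0 : (0 : ℝ) < (U.card * S.card : ℕ) := by exact_mod_cast Nat.mul_pos hU0.card_pos hS0.card_pos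
    rw [div_le_div_iff₀ hn0 (by positivity), one_mul]
    have h1 : 16 * M * (U.card * S.card : ℕ) ≤ (n.factorial : ℝ) := (le_div_iff₀ hγ0).1 hKC
    have h2 : 16 * M * (U.card * S.card : ℕ) * (n : ℝ) ≤ (n.factorial : ℝ) * n :=
      mul_le_mul_of_nonneg_right h1 hn0.le
    have h3 : (0 : ℝ) ≤ M * (U.card * S.card : ℕ) * (n : ℝ) := by positivity
    linarith
  have hlight := pair_light_energy (show 1 ≤ n by omega) U S hU0 hS0 hinjC dC hdC _ hθ
  -- abbreviations
  set f : ℝ := (n.factorial : ℝ) with hf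
  set N : ℝ := ((S.card * T.card * U.card : ℕ) : ℝ) with hN
  set α : ℝ := ((S.card * T.card : ℕ) : ℝ) with hα
  set β : ℝ := ((T.card * U.card : ℕ) : ℝ) with hβ
  set γ : ℝ := ((U.card * S.card : ℕ) : ℝ) with hγ
  have hf0 : 0 < f := by rw [hf]; exact_mod_cast n.factorial_pos
  have hN0 : 0 < N := by
    rw [hN]; exact_mod_cast Nat.mul_pos (Nat.mul_pos hS0.card_pos hT0.card_pos) hU0.card_pos
  have hα0 : 0 < α := by rw [hα]; exact_mod_cast Nat.mul_pos hS0.card_pos hT0.card_pos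
  have hβ0 : 0 < β := by rw [hβ]; exact_mod_cast Nat.mul_pos hT0.card_pos hU0.card_pos
  have hγ0 : 0 < γ := by rw [hγ]; exact_mod_cast Nat.mul_pos hU0.card_pos hS0.card_pos
  have hNsq : α * β * γ = N ^ 2 := by rw [hα, hβ, hγ, hN]; push_cast; ring
  clear_value f N α β γ
  -- the parameters of `kept_ge_of_split`
  set g : ℝ := 100 * (1 + Real.log n) * L / M with hg
  have hg0 : 0 ≤ g := by rw [hg]; positivity
  set θ : ℝ := f / (γ * n * M) with hθdef
  have hEA : 0 ≤ f / α / ((n : ℝ) - 1) := by positivity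
  have hEB : 0 ≤ f / β / ((n : ℝ) - 1) := by positivity
  have hEC : 0 ≤ f / γ / ((n : ℝ) - 1) := by positivity
  -- energy bounds in the form `Σ ≤ K/(n-1)`
  have hA2 : ∑ i : Fin n, ∑ j : Fin n, (dA i j - 1 / n) ^ 2 ≤ f / α / ((n : ℝ) - 1) := by
    rw [le_div_iff₀ hm0, mul_comm]; exact hpA
  have hB2 : ∑ i : Fin n, ∑ j : Fin n, (dB i j - 1 / n) ^ 2 ≤ f / β / ((n : ℝ) - 1) := by
    rw [le_div_iff₀ hm0, mul_comm]; exact hpB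
  have hC2 : ∑ i : Fin n, ∑ j : Fin n, (dC i j - 1 / n) ^ 2 ≤ f / γ / ((n : ℝ) - 1) := by
    rw [le_div_iff₀ hm0, mul_comm]; exact hpC2
  have hlc : ∑ i : Fin n, ∑ j : Fin n, (if θ ≤ dC i j then (0 : ℝ) else dC i j - 1 / n) ^ 2 ≤
      g * (f / γ / ((n : ℝ) - 1)) := by
    refine hlight.trans ?_
    have hP : 0 ≤ 100 * (1 + Real.log n) * ((n : ℝ) * θ) := by positivity
    have hLm : Real.log (4 * n * f / γ) / n ≤ L / ((n : ℝ) - 1) :=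
      (div_le_div_of_nonneg_right hLC hn0.le).trans
        (div_le_div_of_nonneg_left hL0 hm0 (by linarith))
    calc 100 * (1 + Real.log n) * ((n : ℝ) * θ) * Real.log (4 * n * f / γ) / n
        = 100 * (1 + Real.log n) * ((n : ℝ) * θ) * (Real.log (4 * n * f / γ) / n) := by ring
      _ ≤ 100 * (1 + Real.log n) * ((n : ℝ) * θ) * (L / ((n : ℝ) - 1)) :=
          mul_le_mul_of_nonneg_left hLm hP
      _ = g * (f / γ / ((n : ℝ) - 1)) := by
          rw [hg, hθdef]
          field_simp
  have hzero : ∑ _i : Fin n, ∑ _j : Fin n, ((0 : ℝ)) ^ 2 = 0 := by simp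
  -- (4) the kept-term lemma
  have hk := kept_ge_of_split (fun i j => dA i j - 1 / n) (fun j k => dB j k - 1 / n)
    (fun k i => dC k i - 1 / n) (fun i j => dA i j - 1 / n) (fun _ _ => 0)
    (fun j k => dB j k - 1 / n) (fun _ _ => 0) pC
    (fun k i => if θ ≤ dC k i then (0 : ℝ) else dC k i - 1 / n)
    (fun i j => (add_zero _).symm) (fun j k => (add_zero _).symm)
    (fun k i => by
      show dC k i - 1 / n = pC k i + (if θ ≤ dC k i then (0 : ℝ) else dC k i - 1 / n)
      rw [hpC k i]
      split_ifs <;> simp)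
    hn1 (f / α / ((n : ℝ) - 1)) (f / β / ((n : ℝ) - 1)) (f / γ / ((n : ℝ) - 1)) g
    (f / (2 * N) + f * Real.sqrt f / (2 * N * Real.sqrt (((n * (n - 1) : ℕ) : ℝ) / 6)))
    hEA hEB hEC hg0 hB2 hC2 hA2 hB2 (hzero.trans_le (by positivity))
    (hzero.trans_le (by positivity)) hlc (by linarith [hpin])
  -- (5) the loss: `(n-1)·√(E_A E_B E_C) = F/√(n-1)`
  have hsm : 0 < Real.sqrt ((n : ℝ) - 1) := Real.sqrt_pos.2 hm0
  have hE : f / α / ((n : ℝ) - 1) * (f / β / ((n : ℝ) - 1)) * (f / γ / ((n : ℝ) - 1)) =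
      ((f * Real.sqrt f / N) / (((n : ℝ) - 1) * Real.sqrt ((n : ℝ) - 1))) ^ 2 := by
    rw [div_pow, div_pow, mul_pow, mul_pow, Real.sq_sqrt hf0.le, Real.sq_sqrt hm0.le, ← hNsq]
    field_simp
  have hsq : Real.sqrt (f / α / ((n : ℝ) - 1) * (f / β / ((n : ℝ) - 1)) * (f / γ / ((n : ℝ) - 1))) =
      (f * Real.sqrt f / N) / (((n : ℝ) - 1) * Real.sqrt ((n : ℝ) - 1)) := by
    rw [hE, Real.sqrt_sq (by positivity)]
  rw [hsq] at hk
  have hfin : 3 * Real.sqrt g * (f * Real.sqrt f / N) / Real.sqrt ((n : ℝ) - 1) =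
      3 * ((n : ℝ) - 1) * Real.sqrt g *
        ((f * Real.sqrt f / N) / (((n : ℝ) - 1) * Real.sqrt ((n : ℝ) - 1))) := by
    field_simp
  linarith [hk, hfin]

end Summit.MatrixMultiplication.MatrixMultiplication.Theorems.PolynomialSlack
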